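import Mathlib.Data.Real.Basic
import Mathlib.Tactic.Linarith
import Mathlib.Tactic.Positivity
import Mathlib.Tactic.FieldSimp
import Mathlib.Tactic.Ring
import HarnessLib

/-!
# `NoHeavyLowerTail` (crux stmt-CriticalPhenomena-4575), P2 — THE SQUARE LEMMA AND THE REMAINDER BOUNDS FOR THE FOUR EXPLICIT RATIOS
# (pure real-number lemmas behind `I3 ≥ 0`)

Seat `prim-masterthm-p2`, gen 29 (memo `FROM-prim-masterthm-p2-g29-SQUARE-IDENTITY.md`; `--supports stmt-CriticalPhenomena-4575`).
No `sorry`, no named facts, standard axioms; imports Mathlib only (no tree dependency), so that it can land independently.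

CONTEXT (`…SahiHubTwoLevelSquare`): on the (z,c)-square with points `0=(0,0), Z=(0,1), C=(1,0), T=(1,1)` (first index = c-level `i`,
second = hub level `z`; antipode `0 ↔ T`, `Z ↔ C`), the bias-free cross form satisfies `I3 = Σ_b wB S^ρ(b) + CPart ρ + Rpart ρ` with the
antipodal fibre sum `S^ρ(b) = Σ_x g_x(b)T_x(b)`, `T_x = (2−ρ_x)Y_x − F_x̄H_{z(x)} − (1−ρ_x̄)Y_x̄`, and
`Rpart = (G_T−G_0)D_{T0} + (G_Z−G_C)D_{ZC} + (F_T−F_Z)(G_T−G_Z)(H̄_1−H̄_0)`.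
THE FOUR RATIOS `ρ = (ρ_0,ρ_Z,ρ_C,ρ_T)` (all with `ρ_0 = 0`, `ρ_T = 1 − F_0/F_T`):
 A1 `(0,0,(F_C−F_Z)/F_T,·)` [`G_Z ≥ G_C`, `F_Z ≤ F_C`], A2 `(0,1−F_C/F_Z,0,·)` [`G_Z ≥ G_C`, `F_Z > F_C`],
 B1 `(0,0,(F_C−F_Z)/F_C,·)` [`G_Z < G_C`, `F_Z < F_C`],  B2 `(0,(F_Z−F_C)/F_T,0,·)` [`G_Z < G_C`, `F_Z ≥ F_C`].
THIS FILE, on ABSTRACT real data (`F_x`, fibre values `Y_x, H_0, H_1, g_x`, averages `Ȳ_x, H̄_z`):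
* `sq_core` — layer-cake on the square: the five pattern sums (`{T},{Z,T},{C,T},{Z,C,T},all`) `≥ 0` ⟹ `Σ_x g_xT_x ≥ 0` for monotone `g ≥ 0`;
* `patT`, `patZCT`, `patAll` (rule-independent) and `patZT_*`, `patCT_*` (per rule): the pattern sums as EXPLICIT nonnegative combinations
  of the fibre facts `Y_x ≥ F_xH_{z(x)}` (slice bound), `Y` monotone on the square, `0 ≤ H_0 ≤ H_1`;
* `R_core_A/B`, `DT0_rule`, `DZC_*`: the remainder bounds `D_{T0} ≥ 0`, `D_{T0}+D_{ZC} ≥ 0` (case A), `D_{T0}−D_{ZC}+(F_T−F_Z)ΔH̄ ≥ 0` (B)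
  from the averaged slice bounds and `Ȳ` monotone.
The assembly (`crossForm_nonneg`, `twoLevel_nonneg`, `sahiE_three_nonneg_T1C1`) is `…SahiHubTwoLevelI3`. [this work]
-/

noncomputable section

namespace Summit.CriticalPhenomena.PercolationContinuityZ3.Theorems

namespace SahiHubTwoLevel

/-! ## The square lemma on abstract fibre data -/
section Abstract

/-- Layer-cake on the square: if the five pattern sums of `T` over the up-sets `{T}, {Z,T}, {C,T}, {Z,C,T}, all` are nonnegative, then
`Σ_x g_x T_x ≥ 0` for every nonnegative `g` monotone on the square (`g_0 ≤ g_Z, g_C ≤ g_T`). [this work] -/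
theorem sq_core {g0 gZ gC gT T0 TZ TC TT : ℝ} (hg0 : 0 ≤ g0) (h0Z : g0 ≤ gZ) (h0C : g0 ≤ gC) (hZT : gZ ≤ gT) (hCT : gC ≤ gT)
    (pT : 0 ≤ TT) (pZT : 0 ≤ TZ + TT) (pCT : 0 ≤ TC + TT) (pZCT : 0 ≤ TZ + TC + TT) (pAll : 0 ≤ T0 + TZ + TC + TT) :
    0 ≤ gT * TT + gZ * TZ + gC * TC + g0 * T0 := by
  rcases le_total gZ gC with hZC | hCZ
  · have e : gT * TT + gZ * TZ + gC * TC + g0 * T0 =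
        g0 * (T0 + TZ + TC + TT) + (gZ - g0) * (TZ + TC + TT) + (gC - gZ) * (TC + TT) + (gT - gC) * TT := by ring
    rw [e]
    have := mul_nonneg hg0 pAll; have := mul_nonneg (sub_nonneg.2 h0Z) pZCT
    have := mul_nonneg (sub_nonneg.2 hZC) pCT; have := mul_nonneg (sub_nonneg.2 hCT) pT
    linarith
  · have e : gT * TT + gZ * TZ + gC * TC + g0 * T0 =
        g0 * (T0 + TZ + TC + TT) + (gC - g0) * (TZ + TC + TT) + (gZ - gC) * (TZ + TT) + (gT - gZ) * TT := by ring
    rw [e]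
    have := mul_nonneg hg0 pAll; have := mul_nonneg (sub_nonneg.2 h0C) pZCT
    have := mul_nonneg (sub_nonneg.2 hCZ) pZT; have := mul_nonneg (sub_nonneg.2 hZT) pT
    linarith

variable {F0 FZ FC FT H0 H1 Y0 YZ YC YT : ℝ}

/-- Pattern `{T}` (all four rules have `ρ_0 = 0`, `ρ_T = 1 − F_0/F_T`):
`T_T = (F_0/F_T)(Y_T − F_TH_1) + (Y_Z − Y_0) + (Y_T − Y_Z) ≥ 0`. [this work] -/
theorem patT (hFT : 0 < FT) (hF0 : 0 ≤ F0) (sT : FT * H1 ≤ YT) (mZ0 : Y0 ≤ YZ) (mTZ : YZ ≤ YT) :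
    0 ≤ (2 - (1 - F0 / FT)) * YT - F0 * H1 - (1 - 0) * Y0 := by
  have e : (2 - (1 - F0 / FT)) * YT - F0 * H1 - (1 - 0) * Y0 = F0 / FT * (YT - FT * H1) + (YZ - Y0) + (YT - YZ) := by
    field_simp; ring
  rw [e]
  have := mul_nonneg (div_nonneg hF0 hFT.le) (sub_nonneg.2 sT)
  linarith

/-- Pattern `{Z,C,T}` (ρ-free apart from `ρ_T`): `= (F_T−F_Z)H_0 + (F_T−F_C)(H_1−H_0) + (Y_C − F_CH_0) + (1+F_0/F_T)(Y_T−F_TH_1) + (Y_Z−Y_0)`. [this work] -/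
theorem patZCT (hFT : 0 < FT) (hF0 : 0 ≤ F0) (hZT : FZ ≤ FT) (hCTf : FC ≤ FT) (hH0 : 0 ≤ H0) (hH : H0 ≤ H1)
    (sC : FC * H0 ≤ YC) (sT : FT * H1 ≤ YT) (mZ0 : Y0 ≤ YZ) (rZ rC : ℝ) :
    0 ≤ (2 - rZ) * YZ - FC * H1 - (1 - rC) * YC + ((2 - rC) * YC - FZ * H0 - (1 - rZ) * YZ)
      + ((2 - (1 - F0 / FT)) * YT - F0 * H1 - (1 - 0) * Y0) := by
  have e : (2 - rZ) * YZ - FC * H1 - (1 - rC) * YC + ((2 - rC) * YC - FZ * H0 - (1 - rZ) * YZ)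
      + ((2 - (1 - F0 / FT)) * YT - F0 * H1 - (1 - 0) * Y0) =
      (FT - FZ) * H0 + (FT - FC) * (H1 - H0) + (YC - FC * H0) + (1 + F0 / FT) * (YT - FT * H1) + (YZ - Y0) := by
    field_simp; ring
  rw [e]
  have := mul_nonneg (sub_nonneg.2 hZT) hH0; have := mul_nonneg (sub_nonneg.2 hCTf) (sub_nonneg.2 hH)
  have := mul_nonneg (by positivity : (0:ℝ) ≤ 1 + F0 / FT) (sub_nonneg.2 sT)
  linarith

/-- Pattern `all` (ρ-free): `= Σ_x (Y_x − F_xH_{z(x)}) + (F_T+F_Z−F_C−F_0)(H_1−H_0)`. [this work] -/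
theorem patAll (h0Z : F0 ≤ FZ) (hCTf : FC ≤ FT) (hH : H0 ≤ H1)
    (s0 : F0 * H0 ≤ Y0) (sZ : FZ * H1 ≤ YZ) (sC : FC * H0 ≤ YC) (sT : FT * H1 ≤ YT) (r0 rZ rC rT : ℝ) :
    0 ≤ (2 - r0) * Y0 - FT * H0 - (1 - rT) * YT + ((2 - rZ) * YZ - FC * H1 - (1 - rC) * YC)
      + ((2 - rC) * YC - FZ * H0 - (1 - rZ) * YZ) + ((2 - rT) * YT - F0 * H1 - (1 - r0) * Y0) := by
  have := mul_nonneg (by linarith : (0:ℝ) ≤ FT + FZ - FC - F0) (sub_nonneg.2 hH)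
  nlinarith

/-- Pattern `{Z,T}`, rule A1 (`ρ_Z = 0`, `ρ_C = (F_C−F_Z)/F_T`, `F_Z ≤ F_C`). [this work] -/
theorem patZT_A1 (hFT : 0 < FT) (hF0 : 0 ≤ F0) (hZ0 : 0 ≤ FZ) (hZC : FZ ≤ FC) (hCTf : FC ≤ FT)
    (sZ : FZ * H1 ≤ YZ) (sT : FT * H1 ≤ YT) (mZ0 : Y0 ≤ YZ) (mTC : YC ≤ YT) :
    0 ≤ (2 - 0) * YZ - FC * H1 - (1 - (FC - FZ) / FT) * YC + ((2 - (1 - F0 / FT)) * YT - F0 * H1 - (1 - 0) * Y0) := by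
  have e : (2 - 0) * YZ - FC * H1 - (1 - (FC - FZ) / FT) * YC + ((2 - (1 - F0 / FT)) * YT - F0 * H1 - (1 - 0) * Y0) =
      (YZ - FZ * H1) + (F0 + FC - FZ) / FT * (YT - FT * H1) + (YZ - Y0) + (1 - (FC - FZ) / FT) * (YT - YC) := by
    field_simp; ring
  rw [e]
  have c1 : 0 ≤ (F0 + FC - FZ) / FT := div_nonneg (by linarith) hFT.le
  have c2 : 0 ≤ 1 - (FC - FZ) / FT := by
    rw [sub_nonneg, div_le_one hFT]; linarith
  have := mul_nonneg c1 (sub_nonneg.2 sT); have := mul_nonneg c2 (sub_nonneg.2 mTC)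
  linarith

/-- Pattern `{C,T}`, rule A1. [this work] -/
theorem patCT_A1 (hFT : 0 < FT) (hF0 : 0 ≤ F0) (hZ0 : 0 ≤ FZ) (hZC : FZ ≤ FC) (hCTf : FC ≤ FT) (hH0 : 0 ≤ H0)
    (sC : FC * H0 ≤ YC) (sT : FT * H1 ≤ YT) (mC0 : Y0 ≤ YC) (mTZ : YZ ≤ YT) :
    0 ≤ (2 - (FC - FZ) / FT) * YC - FZ * H0 - (1 - 0) * YZ + ((2 - (1 - F0 / FT)) * YT - F0 * H1 - (1 - 0) * Y0) := by
  have e : (2 - (FC - FZ) / FT) * YC - FZ * H0 - (1 - 0) * YZ + ((2 - (1 - F0 / FT)) * YT - F0 * H1 - (1 - 0) * Y0) =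
      (FC - FZ) * (1 - FC / FT) * H0 + (1 - (FC - FZ) / FT) * (YC - FC * H0) + F0 / FT * (YT - FT * H1)
        + (YC - Y0) + (YT - YZ) := by
    field_simp; ring
  rw [e]
  have c1 : 0 ≤ 1 - FC / FT := by rw [sub_nonneg, div_le_one hFT]; exact hCTf
  have c2 : 0 ≤ 1 - (FC - FZ) / FT := by rw [sub_nonneg, div_le_one hFT]; linarith
  have := mul_nonneg (mul_nonneg (sub_nonneg.2 hZC) c1) hH0; have := mul_nonneg c2 (sub_nonneg.2 sC)
  have := mul_nonneg (div_nonneg hF0 hFT.le) (sub_nonneg.2 sT)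
  linarith

/-- Pattern `{Z,T}`, rule A2 (`ρ_Z = 1 − F_C/F_Z`, `ρ_C = 0`, `F_C < F_Z`). [this work] -/
theorem patZT_A2 (hFT : 0 < FT) (hFZ : 0 < FZ) (hF0 : 0 ≤ F0) (hC0 : 0 ≤ FC)
    (sZ : FZ * H1 ≤ YZ) (sT : FT * H1 ≤ YT) (mZ0 : Y0 ≤ YZ) (mTC : YC ≤ YT) :
    0 ≤ (2 - (1 - FC / FZ)) * YZ - FC * H1 - (1 - 0) * YC + ((2 - (1 - F0 / FT)) * YT - F0 * H1 - (1 - 0) * Y0) := by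
  have e : (2 - (1 - FC / FZ)) * YZ - FC * H1 - (1 - 0) * YC + ((2 - (1 - F0 / FT)) * YT - F0 * H1 - (1 - 0) * Y0) =
      FC / FZ * (YZ - FZ * H1) + F0 / FT * (YT - FT * H1) + (YZ - Y0) + (YT - YC) := by
    field_simp; ring
  rw [e]
  have := mul_nonneg (div_nonneg hC0 hFZ.le) (sub_nonneg.2 sZ); have := mul_nonneg (div_nonneg hF0 hFT.le) (sub_nonneg.2 sT)
  linarith

/-- Pattern `{C,T}`, rule A2. [this work] -/
theorem patCT_A2 (hFT : 0 < FT) (hFZ : 0 < FZ) (hF0 : 0 ≤ F0) (hC0 : 0 ≤ FC) (hCZ : FC ≤ FZ) (hZT : FZ ≤ FT) (hH0 : 0 ≤ H0)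
    (hH : H0 ≤ H1)
    (sC : FC * H0 ≤ YC) (sT : FT * H1 ≤ YT) (mC0 : Y0 ≤ YC) (mTZ : YZ ≤ YT) :
    0 ≤ (2 - 0) * YC - FZ * H0 - (1 - (1 - FC / FZ)) * YZ + ((2 - (1 - F0 / FT)) * YT - F0 * H1 - (1 - 0) * Y0) := by
  have e : (2 - 0) * YC - FZ * H0 - (1 - (1 - FC / FZ)) * YZ + ((2 - (1 - F0 / FT)) * YT - F0 * H1 - (1 - 0) * Y0) =
      FC / FZ * (YT - YZ) + (YC - Y0) + F0 / FT * (YT - FT * H1) + (YC - FC * H0)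
        + (1 - FC / FZ) * ((YT - FT * H1) + (FT - FZ) * H1 + FZ * (H1 - H0)) := by
    field_simp; ring
  rw [e]
  have c1 : 0 ≤ 1 - FC / FZ := by rw [sub_nonneg, div_le_one hFZ]; exact hCZ
  have hH1 : 0 ≤ H1 := le_trans hH0 hH
  have i1 : 0 ≤ (YT - FT * H1) + (FT - FZ) * H1 + FZ * (H1 - H0) := by
    have := mul_nonneg (sub_nonneg.2 hZT) hH1; have := mul_nonneg hFZ.le (sub_nonneg.2 hH); linarith
  have := mul_nonneg (div_nonneg hC0 hFZ.le) (sub_nonneg.2 mTZ)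
  have := mul_nonneg (div_nonneg hF0 hFT.le) (sub_nonneg.2 sT); have := mul_nonneg c1 i1
  linarith

/-- Pattern `{Z,T}`, rule B1 (`ρ_Z = 0`, `ρ_C = (F_C−F_Z)/F_C`, `F_Z < F_C`). [this work] -/
theorem patZT_B1 (hFT : 0 < FT) (hFC : 0 < FC) (hF0 : 0 ≤ F0) (hZ0 : 0 ≤ FZ) (hZC : FZ ≤ FC) (hCTf : FC ≤ FT)
    (hH1 : 0 ≤ H1) (sZ : FZ * H1 ≤ YZ) (sT : FT * H1 ≤ YT) (mZ0 : Y0 ≤ YZ) (mTC : YC ≤ YT) :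
    0 ≤ (2 - 0) * YZ - FC * H1 - (1 - (FC - FZ) / FC) * YC + ((2 - (1 - F0 / FT)) * YT - F0 * H1 - (1 - 0) * Y0) := by
  have e : (2 - 0) * YZ - FC * H1 - (1 - (FC - FZ) / FC) * YC + ((2 - (1 - F0 / FT)) * YT - F0 * H1 - (1 - 0) * Y0) =
      (FT - FC) * (1 - FZ / FC) * H1 + (YZ - FZ * H1) + (1 + F0 / FT - FZ / FC) * (YT - FT * H1) + (YZ - Y0)
        + FZ / FC * (YT - YC) := by
    field_simp; ring
  rw [e]
  have c1 : 0 ≤ 1 - FZ / FC := by rw [sub_nonneg, div_le_one hFC]; exact hZC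
  have c2 : 0 ≤ 1 + F0 / FT - FZ / FC := by have := div_nonneg hF0 hFT.le; linarith
  have := mul_nonneg (mul_nonneg (sub_nonneg.2 hCTf) c1) hH1; have := mul_nonneg c2 (sub_nonneg.2 sT)
  have := mul_nonneg (div_nonneg hZ0 hFC.le) (sub_nonneg.2 mTC)
  linarith

/-- Pattern `{C,T}`, rule B1. [this work] -/
theorem patCT_B1 (hFT : 0 < FT) (hFC : 0 < FC) (hF0 : 0 ≤ F0) (hZ0 : 0 ≤ FZ)
    (sC : FC * H0 ≤ YC) (sT : FT * H1 ≤ YT) (mC0 : Y0 ≤ YC) (mTZ : YZ ≤ YT) :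
    0 ≤ (2 - (FC - FZ) / FC) * YC - FZ * H0 - (1 - 0) * YZ + ((2 - (1 - F0 / FT)) * YT - F0 * H1 - (1 - 0) * Y0) := by
  have e : (2 - (FC - FZ) / FC) * YC - FZ * H0 - (1 - 0) * YZ + ((2 - (1 - F0 / FT)) * YT - F0 * H1 - (1 - 0) * Y0) =
      FZ / FC * (YC - FC * H0) + F0 / FT * (YT - FT * H1) + (YC - Y0) + (YT - YZ) := by
    field_simp; ring
  rw [e]
  have := mul_nonneg (div_nonneg hZ0 hFC.le) (sub_nonneg.2 sC); have := mul_nonneg (div_nonneg hF0 hFT.le) (sub_nonneg.2 sT)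
  linarith

/-- Pattern `{Z,T}`, rule B2 (`ρ_Z = (F_Z−F_C)/F_T`, `ρ_C = 0`, `F_C ≤ F_Z`). [this work] -/
theorem patZT_B2 (hFT : 0 < FT) (hFZ : 0 < FZ) (hF0 : 0 ≤ F0) (hC0 : 0 ≤ FC) (hCZ : FC ≤ FZ) (hZT : FZ ≤ FT) (hH1 : 0 ≤ H1)
    (sZ : FZ * H1 ≤ YZ) (sT : FT * H1 ≤ YT) (mZ0 : Y0 ≤ YZ) (mTC : YC ≤ YT) :
    0 ≤ (2 - (FZ - FC) / FT) * YZ - FC * H1 - (1 - 0) * YC + ((2 - (1 - F0 / FT)) * YT - F0 * H1 - (1 - 0) * Y0) := by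
  have e : (2 - (FZ - FC) / FT) * YZ - FC * H1 - (1 - 0) * YC + ((2 - (1 - F0 / FT)) * YT - F0 * H1 - (1 - 0) * Y0) =
      (FC / FZ + (FZ - FC) * (1 / FZ - 1 / FT)) * (YZ - FZ * H1) + (FZ - FC) * (1 / FZ - 1 / FT) * (FZ * H1)
        + F0 / FT * (YT - FT * H1) + (YZ - Y0) + (YT - YC) := by
    field_simp; ring
  rw [e]
  have k : 0 ≤ (FZ - FC) * (1 / FZ - 1 / FT) :=
    mul_nonneg (sub_nonneg.2 hCZ) (sub_nonneg.2 (one_div_le_one_div_of_le hFZ hZT))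
  have := mul_nonneg (add_nonneg (div_nonneg hC0 hFZ.le) k) (sub_nonneg.2 sZ)
  have := mul_nonneg k (mul_nonneg hFZ.le hH1); have := mul_nonneg (div_nonneg hF0 hFT.le) (sub_nonneg.2 sT)
  linarith

/-- Pattern `{C,T}`, rule B2. [this work] -/
theorem patCT_B2 (hFT : 0 < FT) (hF0 : 0 ≤ F0) (hCZ : FC ≤ FZ) (hZT : FZ ≤ FT) (h0C : F0 ≤ FC) (hH : H0 ≤ H1)
    (sC : FC * H0 ≤ YC) (sT : FT * H1 ≤ YT) (mC0 : Y0 ≤ YC) (mTZ : YZ ≤ YT) :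
    0 ≤ (2 - 0) * YC - FZ * H0 - (1 - (FZ - FC) / FT) * YZ + ((2 - (1 - F0 / FT)) * YT - F0 * H1 - (1 - 0) * Y0) := by
  have e : (2 - 0) * YC - FZ * H0 - (1 - (FZ - FC) / FT) * YZ + ((2 - (1 - F0 / FT)) * YT - F0 * H1 - (1 - 0) * Y0) =
      (FZ - FC) * (H1 - H0) + (YC - FC * H0) + (F0 + FZ - FC) / FT * (YT - FT * H1) + (YC - Y0)
        + (1 - (FZ - FC) / FT) * (YT - YZ) := by
    field_simp; ring
  rw [e]
  have c1 : 0 ≤ (F0 + FZ - FC) / FT := div_nonneg (by linarith) hFT.le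
  have c2 : 0 ≤ 1 - (FZ - FC) / FT := by rw [sub_nonneg, div_le_one hFT]; linarith
  have := mul_nonneg (sub_nonneg.2 hCZ) (sub_nonneg.2 hH); have := mul_nonneg c1 (sub_nonneg.2 sT)
  have := mul_nonneg c2 (sub_nonneg.2 mTZ)
  linarith

/-! ### The environment remainder on abstract data -/

variable {a d u Yb0 YbZ YbC YbT Hb0 Hb1 : ℝ}

/-- Case A bookkeeping: `a·D_{T0} + d·D_{ZC} + (F_T−F_Z)u·ΔH̄ ≥ 0` when `0 ≤ d ≤ a`, `u ≥ 0`, `D_{T0} ≥ 0`, `D_{T0}+D_{ZC} ≥ 0`. [this work] -/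
theorem R_core_A {DT DZ : ℝ} (hda : d ≤ a) (hd : 0 ≤ d) (hu : 0 ≤ u) (hZT : FZ ≤ FT) (hH : Hb0 ≤ Hb1)
    (h1 : 0 ≤ DT) (h2 : 0 ≤ DT + DZ) : 0 ≤ a * DT + d * DZ + (FT - FZ) * u * (Hb1 - Hb0) := by
  have e : a * DT + d * DZ + (FT - FZ) * u * (Hb1 - Hb0) = (a - d) * DT + d * (DT + DZ) + (FT - FZ) * u * (Hb1 - Hb0) := by ring
  rw [e]
  have := mul_nonneg (sub_nonneg.2 hda) h1; have := mul_nonneg hd h2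
  have := mul_nonneg (mul_nonneg (sub_nonneg.2 hZT) hu) (sub_nonneg.2 hH)
  linarith

/-- Case B bookkeeping: the same with `d ≤ 0`, `0 ≤ u + d`, `u ≤ a`, `D_{T0} ≥ 0`, `D_{T0} − D_{ZC} + (F_T−F_Z)ΔH̄ ≥ 0`. [this work] -/
theorem R_core_B {DT DZ : ℝ} (hd : d ≤ 0) (hud : 0 ≤ u + d) (hua : u ≤ a) (hZT : FZ ≤ FT) (hH : Hb0 ≤ Hb1)
    (h1 : 0 ≤ DT) (h2 : 0 ≤ DT - DZ + (FT - FZ) * (Hb1 - Hb0)) : 0 ≤ a * DT + d * DZ + (FT - FZ) * u * (Hb1 - Hb0) := by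
  have e : a * DT + d * DZ + (FT - FZ) * u * (Hb1 - Hb0) =
      (a - u) * DT + (u + d) * (DT + (FT - FZ) * (Hb1 - Hb0)) + (-d) * (DT - DZ + (FT - FZ) * (Hb1 - Hb0)) := by ring
  rw [e]
  have k := mul_nonneg (sub_nonneg.2 hZT) (sub_nonneg.2 hH)
  have := mul_nonneg (sub_nonneg.2 hua) h1; have := mul_nonneg hud (add_nonneg h1 k)
  have := mul_nonneg (neg_nonneg.2 hd) h2
  linarith

/-- `D_{T0} ≥ 0` for all four rules (`ρ_T = 1 − F_0/F_T`, `ρ_0 = 0`): from the averaged slice bound `F_TH̄_1 ≤ Ȳ_T`. [this work] -/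
theorem DT0_rule (hFT : 0 < FT) (h0T : F0 ≤ FT) (sT : FT * Hb1 ≤ YbT) :
    0 ≤ (1 - F0 / FT) * YbT - 0 * Yb0 - (FT - F0) * Hb1 := by
  have e : (1 - F0 / FT) * YbT - 0 * Yb0 - (FT - F0) * Hb1 = (FT - F0) / FT * (YbT - FT * Hb1) := by field_simp; ring
  rw [e]; exact mul_nonneg (div_nonneg (sub_nonneg.2 h0T) hFT.le) (sub_nonneg.2 sT)

/-- Rule A1: `D_{T0} + D_{ZC} ≥ 0`. [this work] -/
theorem DZC_A1 (hFT : 0 < FT) (h0Z : F0 ≤ FZ) (hZC : FZ ≤ FC) (hCTf : FC ≤ FT) (sT : FT * Hb1 ≤ YbT) (mTC : YbC ≤ YbT) :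
    0 ≤ (1 - F0 / FT) * YbT - 0 * Yb0 - (FT - F0) * Hb1 + (0 * YbZ - (FC - FZ) / FT * YbC - (FZ - FC) * Hb1) := by
  have e : (1 - F0 / FT) * YbT - 0 * Yb0 - (FT - F0) * Hb1 + (0 * YbZ - (FC - FZ) / FT * YbC - (FZ - FC) * Hb1) =
      (FT - F0 - (FC - FZ)) / FT * (YbT - FT * Hb1) + (FC - FZ) / FT * (YbT - YbC) := by field_simp; ring
  rw [e]
  have := mul_nonneg (div_nonneg (by linarith : (0:ℝ) ≤ FT - F0 - (FC - FZ)) hFT.le) (sub_nonneg.2 sT)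
  have := mul_nonneg (div_nonneg (sub_nonneg.2 hZC) hFT.le) (sub_nonneg.2 mTC)
  linarith

/-- Rule A2: `D_{T0} + D_{ZC} ≥ 0`. [this work] -/
theorem DZC_A2 (hFT : 0 < FT) (hFZ : 0 < FZ) (h0T : F0 ≤ FT) (hCZ : FC ≤ FZ) (sT : FT * Hb1 ≤ YbT) (sZ : FZ * Hb1 ≤ YbZ) :
    0 ≤ (1 - F0 / FT) * YbT - 0 * Yb0 - (FT - F0) * Hb1 + ((1 - FC / FZ) * YbZ - 0 * YbC - (FZ - FC) * Hb1) := by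
  have e : (1 - FC / FZ) * YbZ - 0 * YbC - (FZ - FC) * Hb1 = (FZ - FC) / FZ * (YbZ - FZ * Hb1) := by field_simp; ring
  rw [e]
  exact add_nonneg (DT0_rule hFT h0T sT) (mul_nonneg (div_nonneg (sub_nonneg.2 hCZ) hFZ.le) (sub_nonneg.2 sZ))

/-- Rule B1: `D_{T0} − D_{ZC} + (F_T−F_Z)ΔH̄ ≥ 0`. [this work] -/
theorem DZC_B1 (hFT : 0 < FT) (hFC : 0 < FC) (h0T : F0 ≤ FT) (hZC : FZ ≤ FC) (hCTf : FC ≤ FT) (hH : Hb0 ≤ Hb1)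
    (sT : FT * Hb1 ≤ YbT) (sC : FC * Hb0 ≤ YbC) :
    0 ≤ (1 - F0 / FT) * YbT - 0 * Yb0 - (FT - F0) * Hb1 - (0 * YbZ - (FC - FZ) / FC * YbC - (FZ - FC) * Hb1)
      + (FT - FZ) * (Hb1 - Hb0) := by
  have e : (1 - F0 / FT) * YbT - 0 * Yb0 - (FT - F0) * Hb1 - (0 * YbZ - (FC - FZ) / FC * YbC - (FZ - FC) * Hb1)
      + (FT - FZ) * (Hb1 - Hb0) =
      ((1 - F0 / FT) * YbT - 0 * Yb0 - (FT - F0) * Hb1) + (FC - FZ) / FC * (YbC - FC * Hb0) + (FT - FC) * (Hb1 - Hb0) := by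
    field_simp; ring
  rw [e]
  have := DT0_rule (Yb0 := Yb0) hFT h0T sT
  have := mul_nonneg (div_nonneg (sub_nonneg.2 hZC) hFC.le) (sub_nonneg.2 sC)
  have := mul_nonneg (sub_nonneg.2 hCTf) (sub_nonneg.2 hH)
  linarith

/-- Rule B2: `D_{T0} − D_{ZC} + (F_T−F_Z)ΔH̄ ≥ 0`. [this work] -/
theorem DZC_B2 (hFT : 0 < FT) (hCZ : FC ≤ FZ) (hZT : FZ ≤ FT) (h0C : F0 ≤ FC) (hH : Hb0 ≤ Hb1)
    (sT : FT * Hb1 ≤ YbT) (mTZ : YbZ ≤ YbT) :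
    0 ≤ (1 - F0 / FT) * YbT - 0 * Yb0 - (FT - F0) * Hb1 - ((FZ - FC) / FT * YbZ - 0 * YbC - (FZ - FC) * Hb1)
      + (FT - FZ) * (Hb1 - Hb0) := by
  have e : (1 - F0 / FT) * YbT - 0 * Yb0 - (FT - F0) * Hb1 - ((FZ - FC) / FT * YbZ - 0 * YbC - (FZ - FC) * Hb1)
      + (FT - FZ) * (Hb1 - Hb0) =
      (FT - F0 - (FZ - FC)) / FT * (YbT - FT * Hb1) + (FZ - FC) / FT * (YbT - YbZ) + (FT - FZ) * (Hb1 - Hb0) := by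
    field_simp; ring
  rw [e]
  have := mul_nonneg (div_nonneg (by linarith : (0:ℝ) ≤ FT - F0 - (FZ - FC)) hFT.le) (sub_nonneg.2 sT)
  have := mul_nonneg (div_nonneg (sub_nonneg.2 hCZ) hFT.le) (sub_nonneg.2 mTZ)
  have := mul_nonneg (sub_nonneg.2 hZT) (sub_nonneg.2 hH)
  linarith

end Abstract

end SahiHubTwoLevel

end Summit.CriticalPhenomena.PercolationContinuityZ3.Theorems
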